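import Summits.SmoothPoincare4.SmoothPoincare4.Theorems.DottedCircleRasmussenDcrGapHelperHandlebodyChartModelHandlesBaseBall

/-!
# Helper `helper_handlebodyChart_modelHandles` (M3: handle structure of the model dotted handlebody `D_k`)
# of line `mk_friends` for crux `DcrGap` — handle charts, part 7: tools for the cover of the arches
(item stmt-SmoothPoincare4-16128, route route-SmoothPoincare4-DottedCircleRasmussen)

Towards the registered stub `helper_handlebodyChart_modelHandles_data_part1`, whose last clause asks that each
handle chart `h j` cover an explicit arch `A_j ⊆ h j (T)`.  The cover is proved by continuation: the image of the
parameter box under `h j` is compact, open at interior parameters (inverse function theorem), and its boundary misses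
the arch, so it contains every connected set it meets.  This file provides the two abstract ingredients:

* `ModelHandles.subset_image_of_open_at`: **continuation** — if `f` is continuous on a compact `K`, open at the
  points of an open `U ⊆ K`, every point of `K` mapped into `A` lies in `U`, and the preconnected `A` meets
  `f(U)`, then `A ⊆ f(K)`;
* `ModelHandles.isPathConnected_archFrame`: **the planar arch is path connected** — in the frame of the hole
  direction (hole at `V ∈ ℝ`, `V ≥ 20`) the arch is the union of the cap
  `{8/5 ≤ |p - V| ≤ 41/25, Re p - V ≥ -7/10}` and the two leg wedges
  `{2/15 ≤ |p| ≤ V + 1/2, Re p > 0, 8/5 |p| ≤ |V Im p| ≤ 41/25 |p|}`, joined at `V ± (81/50) i`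
  (paths: arcs and radial segments in the cap, radial then vertical segments in the legs).

Registered summary `helper_handlebodyChart_modelHandles_coverTools`.  No definitions, no named facts, no `sorry`.
References: R. Kirby, *The Topology of 4-Manifolds*, LNM 1374 (1989), Ch. I §2 [Kirby1989].
-/

-- the prescribed namespace `Summit.<P>.<Sub>.…` duplicates `SmoothPoincare4` (P = Sub)
set_option linter.dupNamespace false
set_option linter.style.longLine false
noncomputable section

open scoped Topology unitInterval
open Function Set Metric Filter

namespace Summit.SmoothPoincare4.SmoothPoincare4.Theorems.DcrGap.MkFriends

namespace ModelHandles

/-! ## Continuation -/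

/-- **Continuation**: `f` continuous on the compact `K`, open at the points of the open `U ⊆ K`, points of `K`
with image in `A` lie in `U`, `A` preconnected and meeting `f(U)` ⟹ `A ⊆ f(K)` (`A ∩ f(K)` is closed and open
in `A`). [folklore] -/
theorem subset_image_of_open_at {X Y : Type*} [TopologicalSpace X] [TopologicalSpace Y] [T2Space Y]
    {f : X → Y} {K U : Set X} {A : Set Y} (hK : IsCompact K) (hf : ContinuousOn f K) (hUK : U ⊆ K)
    (hUo : IsOpen U) (hopen : ∀ p ∈ U, ∀ s ∈ 𝓝 p, f '' s ∈ 𝓝 (f p)) (hA : IsPreconnected A)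
    (havoid : ∀ p ∈ K, f p ∈ A → p ∈ U) (hne : (A ∩ f '' U).Nonempty) : A ⊆ f '' K := by
  have hcl : IsClosed (f '' K) := (hK.image_of_continuousOn hf).isClosed
  have hint : ∀ y ∈ A, y ∈ f '' K → f '' K ∈ 𝓝 y := by
    rintro y hy ⟨p, hp, rfl⟩
    have hpU := havoid p hp hy
    exact mem_of_superset (hopen p hpU U (hUo.mem_nhds hpU)) (image_mono hUK)
  have hsub : A ⊆ interior (f '' K) ∪ (f '' K)ᶜ := fun y hy => by
    by_cases h : y ∈ f '' K
    · exact Or.inl (mem_interior_iff_mem_nhds.2 (hint y hy h))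
    · exact Or.inr h
  have hne' : (A ∩ interior (f '' K)).Nonempty := by
    obtain ⟨y, hyA, p, hpU, rfl⟩ := hne
    exact ⟨f p, hyA, mem_interior_iff_mem_nhds.2 (hint _ hyA ⟨p, hUK hpU, rfl⟩)⟩
  have h := hA.subset_left_of_subset_union isOpen_interior hcl.isOpen_compl
    (disjoint_compl_right.mono_left interior_subset) hsub hne'
  exact h.trans interior_subset

/-! ## The cap of the arch -/

/-- **The cap is joined to its apex**: every point of the cap `{8/5 ≤ |p - V| ≤ 41/25, Re p - V ≥ -7/10}` is joined
inside the cap to `V + 81/50` (rotate about the hole towards the far side, then move radially). [folklore] -/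
theorem cap_joined (V : ℝ) {p : ℂ} (h1 : 8 / 5 ≤ ‖p - V‖) (h2 : ‖p - V‖ ≤ 41 / 25) (h3 : -(7 / 10) ≤ p.re - V) :
    JoinedIn {p : ℂ | 8 / 5 ≤ ‖p - V‖ ∧ ‖p - V‖ ≤ 41 / 25 ∧ -(7 / 10) ≤ p.re - V} p ((V + 81 / 50 : ℝ) : ℂ) := by
  set d : ℂ := p - V with hd
  have hd0 : d ≠ 0 := by intro h0; rw [h0, norm_zero] at h1; norm_num at h1
  have hpol : ((‖d‖ : ℝ) : ℂ) * Complex.exp ((Complex.arg d : ℂ) * Complex.I) = d := Complex.norm_mul_exp_arg_mul_I d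
  have hre : d.re = ‖d‖ * Real.cos (Complex.arg d) := by
    rw [Complex.cos_arg hd0]; field_simp
  -- first leg of the path: the arc
  have harc : JoinedIn {p : ℂ | 8 / 5 ≤ ‖p - V‖ ∧ ‖p - V‖ ≤ 41 / 25 ∧ -(7 / 10) ≤ p.re - V} p ((V : ℂ) + ‖d‖) := by
    refine JoinedIn.ofLine (f := fun t : ℝ => (V : ℂ) + ((‖d‖ : ℝ) : ℂ) * Complex.exp ((((1 - t) * Complex.arg d : ℝ) : ℂ) * Complex.I))
      (by fun_prop) ?_ ?_ ?_
    · simp only [sub_zero, one_mul]; rw [hpol, hd]; ring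
    · simp
    · rintro _ ⟨t, ht, rfl⟩
      have hnorm : ‖(V : ℂ) + ((‖d‖ : ℝ) : ℂ) * Complex.exp ((((1 - t) * Complex.arg d : ℝ) : ℂ) * Complex.I) - V‖ = ‖d‖ := by
        rw [add_sub_cancel_left, norm_mul, Complex.norm_exp_ofReal_mul_I, mul_one, Complex.norm_real, norm_norm]
      refine ⟨by rw [hnorm]; exact h1, by rw [hnorm]; exact h2, ?_⟩
      have hcos : Real.cos (Complex.arg d) ≤ Real.cos ((1 - t) * Complex.arg d) := by
        rw [← Real.cos_abs (Complex.arg d), ← Real.cos_abs ((1 - t) * Complex.arg d), abs_mul,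
          abs_of_nonneg (by linarith [ht.2] : (0 : ℝ) ≤ 1 - t)]
        have hφπ : |Complex.arg d| ≤ Real.pi := Complex.abs_arg_le_pi d
        exact Real.cos_le_cos_of_nonneg_of_le_pi (by nlinarith [abs_nonneg (Complex.arg d), ht.2]) hφπ
          (by nlinarith [abs_nonneg (Complex.arg d), ht.1])
      have e : ((V : ℂ) + ((‖d‖ : ℝ) : ℂ) * Complex.exp ((((1 - t) * Complex.arg d : ℝ) : ℂ) * Complex.I)).re - V =
          ‖d‖ * Real.cos ((1 - t) * Complex.arg d) := by
        rw [Complex.add_re, Complex.ofReal_re, Complex.re_ofReal_mul, Complex.exp_ofReal_mul_I_re]; ring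
      rw [e]
      calc -(7 / 10) ≤ p.re - V := h3
        _ = d.re := by simp [hd]
        _ = ‖d‖ * Real.cos (Complex.arg d) := hre
        _ ≤ ‖d‖ * Real.cos ((1 - t) * Complex.arg d) := by gcongr
  -- second leg: radial
  refine harc.trans (JoinedIn.ofLine (f := fun t : ℝ => (V : ℂ) + (((1 - t) * ‖d‖ + t * (81 / 50) : ℝ) : ℂ))
    (by fun_prop) (by simp) (by push_cast; ring) ?_)
  rintro _ ⟨t, ht, rfl⟩
  have h81 : (8 / 5 : ℝ) ≤ (1 - t) * ‖d‖ + t * (81 / 50) ∧ (1 - t) * ‖d‖ + t * (81 / 50) ≤ 41 / 25 := by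
    constructor <;> nlinarith [ht.1, ht.2]
  have hnorm : ‖(V : ℂ) + (((1 - t) * ‖d‖ + t * (81 / 50) : ℝ) : ℂ) - V‖ = (1 - t) * ‖d‖ + t * (81 / 50) := by
    rw [add_sub_cancel_left, Complex.norm_real, Real.norm_eq_abs, abs_of_nonneg (by linarith [h81.1])]
  refine ⟨by rw [hnorm]; exact h81.1, by rw [hnorm]; exact h81.2, ?_⟩
  simp only [Complex.add_re, Complex.ofReal_re]
  linarith [h81.1]

/-! ## The legs of the arch -/

/-- Positive real multiples stay in a leg wedge as long as the norm stays in `[2/15, V + 1/2]`. [folklore] -/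
theorem leg_mem_smul {V ε : ℝ} {p : ℂ} (h3 : 0 < p.re) (h4 : 8 / 5 * ‖p‖ ≤ ε * (V * p.im))
    (h5 : ε * (V * p.im) ≤ 41 / 25 * ‖p‖) {s : ℝ} (hs : 0 < s) (hlo : 2 / 15 ≤ s * ‖p‖) (hhi : s * ‖p‖ ≤ V + 1 / 2) :
    (s : ℂ) * p ∈ {p : ℂ | 2 / 15 ≤ ‖p‖ ∧ ‖p‖ ≤ V + 1 / 2 ∧ 0 < p.re ∧ 8 / 5 * ‖p‖ ≤ ε * (V * p.im) ∧ ε * (V * p.im) ≤ 41 / 25 * ‖p‖} := by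
  have hn : ‖(s : ℂ) * p‖ = s * ‖p‖ := by rw [norm_mul, Complex.norm_real, Real.norm_eq_abs, abs_of_pos hs]
  simp only [mem_setOf_eq, hn, Complex.re_ofReal_mul, Complex.im_ofReal_mul]
  refine ⟨hlo, hhi, mul_pos hs h3, ?_, ?_⟩
  · have := mul_le_mul_of_nonneg_left h4 hs.le; nlinarith
  · have := mul_le_mul_of_nonneg_left h5 hs.le; nlinarith

/-- Points `V + i ε Y` of the vertical segment at the hole's abscissa lie in the leg wedge when
`2.56 (V² + Y²) ≤ V² Y² ≤ 2.6896 (V² + Y²)`, `Y > 0` (`V ≥ 20`, `ε = ±1`). [folklore] -/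
theorem leg_vertical_mem {V ε Y : ℝ} (hV : 20 ≤ V) (hε2 : ε ^ 2 = 1) (hY : 0 < Y)
    (hlo : (8 / 5) ^ 2 * (V ^ 2 + Y ^ 2) ≤ V ^ 2 * Y ^ 2) (hhi : V ^ 2 * Y ^ 2 ≤ (41 / 25) ^ 2 * (V ^ 2 + Y ^ 2)) :
    (V : ℂ) + ((ε * Y : ℝ) : ℂ) * Complex.I ∈
      {p : ℂ | 2 / 15 ≤ ‖p‖ ∧ ‖p‖ ≤ V + 1 / 2 ∧ 0 < p.re ∧ 8 / 5 * ‖p‖ ≤ ε * (V * p.im) ∧ ε * (V * p.im) ≤ 41 / 25 * ‖p‖} := by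
  have hV0 : 0 < V := by linarith
  set c : ℂ := (V : ℂ) + ((ε * Y : ℝ) : ℂ) * Complex.I with hc
  have hcn : ‖c‖ ^ 2 = V ^ 2 + Y ^ 2 := by
    have : ‖c‖ = Real.sqrt (V ^ 2 + (ε * Y) ^ 2) := Complex.norm_add_mul_I V (ε * Y)
    rw [this, Real.sq_sqrt (by positivity)]; nlinarith
  have hcre : c.re = V := by simp [hc]
  have hcim : c.im = ε * Y := by simp [hc]
  have hn0 : 0 ≤ ‖c‖ := norm_nonneg c
  have hY2 : Y ^ 2 ≤ 11 / 4 := by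
    by_contra hY2
    push Not at hY2
    have hV2 : (400 : ℝ) ≤ V ^ 2 := by nlinarith
    nlinarith [mul_le_mul hV2 hY2.le (by norm_num) (by positivity)]
  simp only [mem_setOf_eq, hcre, hcim]
  have hεε : ε * ε = 1 := by nlinarith
  have hεY : ε * (V * (ε * Y)) = V * Y := by linear_combination V * Y * hεε
  rw [hεY]
  refine ⟨by nlinarith, ?_, hV0, ?_, ?_⟩
  · have : ‖c‖ ^ 2 ≤ (V + 1 / 2) ^ 2 := by nlinarith
    exact (pow_le_pow_iff_left₀ hn0 (by linarith) two_ne_zero).1 this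
  · have : (8 / 5 * ‖c‖) ^ 2 ≤ (V * Y) ^ 2 := by nlinarith
    exact (pow_le_pow_iff_left₀ (by positivity) (by positivity) two_ne_zero).1 this
  · have : (V * Y) ^ 2 ≤ (41 / 25 * ‖c‖) ^ 2 := by nlinarith
    exact (pow_le_pow_iff_left₀ (by positivity) (by positivity) two_ne_zero).1 this

/-- **A leg is joined to its junction with the cap**: every point of the leg wedge
`{2/15 ≤ |p| ≤ V + 1/2, Re p > 0, 8/5 |p| ≤ ε V Im p ≤ 41/25 |p|}` (`ε = ±1`, `V ≥ 20`) is joined inside it to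
`V + ε (81/50) i` (radially to `Re p = V`, then vertically). [folklore] -/
theorem leg_joined {V ε : ℝ} (hV : 20 ≤ V) (hε2 : ε ^ 2 = 1) {p : ℂ} (h1 : 2 / 15 ≤ ‖p‖) (h2 : ‖p‖ ≤ V + 1 / 2)
    (h3 : 0 < p.re) (h4 : 8 / 5 * ‖p‖ ≤ ε * (V * p.im)) (h5 : ε * (V * p.im) ≤ 41 / 25 * ‖p‖) :
    JoinedIn {p : ℂ | 2 / 15 ≤ ‖p‖ ∧ ‖p‖ ≤ V + 1 / 2 ∧ 0 < p.re ∧ 8 / 5 * ‖p‖ ≤ ε * (V * p.im) ∧ ε * (V * p.im) ≤ 41 / 25 * ‖p‖}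
      p ((V : ℂ) + ((ε * (81 / 50) : ℝ) : ℂ) * Complex.I) := by
  have hV0 : 0 < V := by linarith
  have hV2 : (400 : ℝ) ≤ V ^ 2 := by
    have := pow_le_pow_left₀ (by norm_num) hV 2; norm_num at this; exact this
  have hnp : 0 < ‖p‖ := by linarith
  have hsq : ‖p‖ ^ 2 = p.re ^ 2 + p.im ^ 2 := by rw [← Complex.normSq_eq_norm_sq, Complex.normSq_apply]; ring
  have hVim : 0 < ε * (V * p.im) := by linarith
  have hεsq : (ε * (V * p.im)) ^ 2 = V ^ 2 * p.im ^ 2 := by rw [mul_pow, mul_pow, hε2, one_mul]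
  have him2 : V ^ 2 * p.im ^ 2 ≤ (41 / 25) ^ 2 * ‖p‖ ^ 2 := by
    have h := pow_le_pow_left₀ hVim.le h5 2
    rw [hεsq, mul_pow] at h; exact h
  have hlo2 : (8 / 5) ^ 2 * ‖p‖ ^ 2 ≤ V ^ 2 * p.im ^ 2 := by
    have h := pow_le_pow_left₀ (by positivity) h4 2
    rw [hεsq, mul_pow] at h; exact h
  -- the wedge is thin: `V |p| ≤ (V + 1/2) Re p`
  have hre_big : V * ‖p‖ ≤ (V + 1 / 2) * p.re := by
    have k1 : (39731 / 100) * p.im ^ 2 ≤ (41 / 25) ^ 2 * p.re ^ 2 := by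
      have := mul_le_mul_of_nonneg_right (by linarith : (39731 / 100 : ℝ) ≤ V ^ 2 - (41 / 25) ^ 2) (sq_nonneg p.im)
      rw [hsq] at him2; linarith
    have k2 : 20 * p.re ^ 2 ≤ V * p.re ^ 2 := mul_le_mul_of_nonneg_right hV (sq_nonneg _)
    have hsq2 : (V * ‖p‖) ^ 2 ≤ ((V + 1 / 2) * p.re) ^ 2 := by
      rw [mul_pow, hsq] at *
      rw [hsq] at him2
      nlinarith [k1, k2, him2]
    exact (pow_le_pow_iff_left₀ (by positivity) (by positivity) two_ne_zero).1 hsq2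
  have hend : 2 / 15 ≤ V / p.re * ‖p‖ ∧ V / p.re * ‖p‖ ≤ V + 1 / 2 := by
    rw [div_mul_eq_mul_div, le_div_iff₀ h3, div_le_iff₀ h3]
    have : p.re ≤ ‖p‖ := Complex.re_le_norm p
    have := mul_nonneg (by linarith : (0 : ℝ) ≤ V - 2 / 15) hnp.le
    constructor <;> linarith
  set y₁ : ℝ := V * p.im / p.re with hy₁
  have hY1 : 0 < ε * y₁ := by
    rw [hy₁, show ε * (V * p.im / p.re) = ε * (V * p.im) / p.re by ring]; exact div_pos hVim h3
  have hcone1 : (8 / 5) ^ 2 * (V ^ 2 + (ε * y₁) ^ 2) ≤ V ^ 2 * (ε * y₁) ^ 2 ∧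
      V ^ 2 * (ε * y₁) ^ 2 ≤ (41 / 25) ^ 2 * (V ^ 2 + (ε * y₁) ^ 2) := by
    have e1 : (ε * y₁) ^ 2 = (V / p.re) ^ 2 * p.im ^ 2 := by
      rw [mul_pow, hε2, one_mul, hy₁]; field_simp
    have e2 : V ^ 2 + (V / p.re) ^ 2 * p.im ^ 2 = (V / p.re) ^ 2 * ‖p‖ ^ 2 := by
      rw [hsq]; field_simp
    rw [e1, e2]
    have hpos : 0 ≤ (V / p.re) ^ 2 := sq_nonneg _
    have k1 := mul_le_mul_of_nonneg_left hlo2 hpos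
    have k2 := mul_le_mul_of_nonneg_left him2 hpos
    constructor <;> linarith
  -- the scaled point `p₁ = (V / Re p) p = V + i y₁`
  have hp1 : ((V / p.re : ℝ) : ℂ) * p = (V : ℂ) + (y₁ : ℂ) * Complex.I := by
    apply Complex.ext
    · simp; field_simp
    · simp [hy₁]; ring
  -- path A: radial scaling
  have hA : JoinedIn {p : ℂ | 2 / 15 ≤ ‖p‖ ∧ ‖p‖ ≤ V + 1 / 2 ∧ 0 < p.re ∧ 8 / 5 * ‖p‖ ≤ ε * (V * p.im) ∧ ε * (V * p.im) ≤ 41 / 25 * ‖p‖}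
      p ((V : ℂ) + (y₁ : ℂ) * Complex.I) := by
    rw [← hp1]
    refine JoinedIn.ofLine (f := fun t : ℝ => (((1 - t) + t * (V / p.re) : ℝ) : ℂ) * p) (by fun_prop) (by simp)
      (by simp) ?_
    rintro _ ⟨t, ht, rfl⟩
    have h1t : 0 ≤ 1 - t := by linarith [ht.2]
    have hs : 0 < (1 - t) + t * (V / p.re) := by
      have hq : 0 < V / p.re := div_pos hV0 h3
      rcases le_total 1 (V / p.re) with h | h
      · have := mul_nonneg ht.1 (sub_nonneg.2 h); linarith
      · have := mul_nonneg h1t (sub_nonneg.2 h); nlinarith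
    refine leg_mem_smul h3 h4 h5 hs ?_ ?_
    · have e : ((1 - t) + t * (V / p.re)) * ‖p‖ = (1 - t) * ‖p‖ + t * (V / p.re * ‖p‖) := by ring
      have k1 := mul_le_mul_of_nonneg_left h1 h1t
      have k2 := mul_le_mul_of_nonneg_left hend.1 ht.1
      rw [e]; linarith
    · have e : ((1 - t) + t * (V / p.re)) * ‖p‖ = (1 - t) * ‖p‖ + t * (V / p.re * ‖p‖) := by ring
      have k1 := mul_le_mul_of_nonneg_left h2 h1t
      have k2 := mul_le_mul_of_nonneg_left hend.2 ht.1
      rw [e]; linarith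
  have hA0 : (0 : ℝ) ≤ V ^ 2 - (8 / 5) ^ 2 := by linarith
  have hB0 : (0 : ℝ) ≤ V ^ 2 - (41 / 25) ^ 2 := by linarith
  have hc81 : (8 / 5 : ℝ) ^ 2 * (V ^ 2 + (81 / 50) ^ 2) ≤ V ^ 2 * (81 / 50) ^ 2 ∧
      V ^ 2 * (81 / 50 : ℝ) ^ 2 ≤ (41 / 25) ^ 2 * (V ^ 2 + (81 / 50) ^ 2) := by
    constructor <;> linarith
  -- path B: vertical segment from `V + i y₁` to `V + i ε 81/50`
  refine hA.trans (JoinedIn.ofLine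
    (f := fun t : ℝ => (V : ℂ) + ((ε * ((1 - t) * (ε * y₁) + t * (81 / 50)) : ℝ) : ℂ) * Complex.I) (by fun_prop) ?_ ?_ ?_)
  · have hεε : ε * ε = 1 := by rw [← sq]; exact hε2
    have : ε * (ε * y₁) = y₁ := by linear_combination y₁ * hεε
    simp only [sub_zero, one_mul, zero_mul, add_zero]
    rw [this]
  · simp
  · rintro _ ⟨t, ht, rfl⟩
    clear hA hp1
    have h1t : 0 ≤ 1 - t := by linarith [ht.2]
    set Y : ℝ := (1 - t) * (ε * y₁) + t * (81 / 50) with hY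
    have e1 : Y = ε * y₁ + t * (81 / 50 - ε * y₁) := by rw [hY]; ring
    have e2 : Y = 81 / 50 + (1 - t) * (ε * y₁ - 81 / 50) := by rw [hY]; ring
    show (V : ℂ) + ((ε * Y : ℝ) : ℂ) * Complex.I ∈ _
    rcases le_total (ε * y₁) (81 / 50) with hle | hle
    · have hYge : ε * y₁ ≤ Y := by have := mul_nonneg ht.1 (sub_nonneg.2 hle); linarith
      have hYle : Y ≤ 81 / 50 := by have := mul_nonpos_of_nonneg_of_nonpos h1t (sub_nonpos.2 hle); linarith
      have hYpos : 0 < Y := by linarith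
      have hY2a : (ε * y₁) ^ 2 ≤ Y ^ 2 := pow_le_pow_left₀ hY1.le hYge 2
      have hY2b : Y ^ 2 ≤ (81 / 50) ^ 2 := pow_le_pow_left₀ hYpos.le hYle 2
      refine leg_vertical_mem hV hε2 hYpos ?_ ?_
      · have := mul_le_mul_of_nonneg_left hY2a hA0; linarith [hcone1.1]
      · have := mul_le_mul_of_nonneg_left hY2b hB0; linarith [hc81.2]
    · have hYge : 81 / 50 ≤ Y := by have := mul_nonneg h1t (sub_nonneg.2 hle); linarith
      have hYle : Y ≤ ε * y₁ := by have := mul_nonpos_of_nonneg_of_nonpos ht.1 (sub_nonpos.2 hle); linarith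
      have hYpos : 0 < Y := by linarith
      have hY2a : (81 / 50 : ℝ) ^ 2 ≤ Y ^ 2 := pow_le_pow_left₀ (by norm_num) hYge 2
      have hY2b : Y ^ 2 ≤ (ε * y₁) ^ 2 := pow_le_pow_left₀ hYpos.le hYle 2
      refine leg_vertical_mem hV hε2 hYpos ?_ ?_
      · have := mul_le_mul_of_nonneg_left hY2a hA0; linarith [hc81.1]
      · have := mul_le_mul_of_nonneg_left hY2b hB0; linarith [hcone1.2]

/-- **The junction points `V ± (81/50) i` lie in the cap and in the legs** (`V ≥ 20`). [folklore] -/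
theorem junction_mem {V ε : ℝ} (hV : 20 ≤ V) (hε : ε = 1 ∨ ε = -1) :
    (8 / 5 ≤ ‖(V : ℂ) + ((ε * (81 / 50) : ℝ) : ℂ) * Complex.I - V‖ ∧ ‖(V : ℂ) + ((ε * (81 / 50) : ℝ) : ℂ) * Complex.I - V‖ ≤ 41 / 25 ∧
      -(7 / 10) ≤ ((V : ℂ) + ((ε * (81 / 50) : ℝ) : ℂ) * Complex.I).re - V) ∧
    (V : ℂ) + ((ε * (81 / 50) : ℝ) : ℂ) * Complex.I ∈
      {p : ℂ | 2 / 15 ≤ ‖p‖ ∧ ‖p‖ ≤ V + 1 / 2 ∧ 0 < p.re ∧ 8 / 5 * ‖p‖ ≤ ε * (V * p.im) ∧ ε * (V * p.im) ≤ 41 / 25 * ‖p‖} := by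
  have hεabs : |ε| = 1 := by rcases hε with h | h <;> rw [h] <;> norm_num
  have hε2 : ε ^ 2 = 1 := by rcases hε with h | h <;> rw [h] <;> norm_num
  have hn : ‖(V : ℂ) + ((ε * (81 / 50) : ℝ) : ℂ) * Complex.I - V‖ = 81 / 50 := by
    rw [add_sub_cancel_left, norm_mul, Complex.norm_I, mul_one, Complex.norm_real, Real.norm_eq_abs, abs_mul, hεabs,
      one_mul]
    norm_num
  refine ⟨⟨by rw [hn]; norm_num, by rw [hn]; norm_num, ?_⟩, ?_⟩
  · rw [Complex.add_re, Complex.ofReal_re, Complex.re_ofReal_mul, Complex.I_re]; norm_num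
  have hV2 : (400 : ℝ) ≤ V ^ 2 := by nlinarith
  exact leg_vertical_mem hV hε2 (by norm_num) (by nlinarith) (by nlinarith)

/-- **The planar arch is path connected** (`V ≥ 20`): the cap and the two leg wedges, joined at `V ± (81/50) i`.
[folklore] -/
theorem isPathConnected_archFrame {V : ℝ} (hV : 20 ≤ V) :
    IsPathConnected {p : ℂ | (8 / 5 ≤ ‖p - V‖ ∧ ‖p - V‖ ≤ 41 / 25 ∧ -(7 / 10) ≤ p.re - V) ∨
      (2 / 15 ≤ ‖p‖ ∧ ‖p‖ ≤ V + 1 / 2 ∧ 0 < p.re ∧ 8 / 5 * ‖p‖ ≤ |V * p.im| ∧ |V * p.im| ≤ 41 / 25 * ‖p‖)} := by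
  have hV0 : 0 < V := by linarith
  set S := {p : ℂ | (8 / 5 ≤ ‖p - V‖ ∧ ‖p - V‖ ≤ 41 / 25 ∧ -(7 / 10) ≤ p.re - V) ∨
      (2 / 15 ≤ ‖p‖ ∧ ‖p‖ ≤ V + 1 / 2 ∧ 0 < p.re ∧ 8 / 5 * ‖p‖ ≤ |V * p.im| ∧ |V * p.im| ≤ 41 / 25 * ‖p‖)} with hS
  have hcapS : {p : ℂ | 8 / 5 ≤ ‖p - V‖ ∧ ‖p - V‖ ≤ 41 / 25 ∧ -(7 / 10) ≤ p.re - V} ⊆ S := fun p hp => Or.inl hp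
  have hlegS : ∀ ε : ℝ, (ε = 1 ∨ ε = -1) →
      {p : ℂ | 2 / 15 ≤ ‖p‖ ∧ ‖p‖ ≤ V + 1 / 2 ∧ 0 < p.re ∧ 8 / 5 * ‖p‖ ≤ ε * (V * p.im) ∧ ε * (V * p.im) ≤ 41 / 25 * ‖p‖} ⊆ S := by
    rintro ε hε p ⟨h1, h2, h3, h4, h5⟩
    have hεabs : |ε| = 1 := by rcases hε with h | h <;> rw [h] <;> norm_num
    have habs : |V * p.im| = ε * (V * p.im) := by
      have h0 : 0 ≤ ε * (V * p.im) := le_trans (by positivity) h4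
      rw [← abs_of_nonneg h0, abs_mul ε (V * p.im), hεabs, one_mul]
    exact Or.inr ⟨h1, h2, h3, by rw [habs]; exact h4, by rw [habs]; exact h5⟩
  have hapex : ((V + 81 / 50 : ℝ) : ℂ) ∈ S := by
    refine Or.inl ⟨?_, ?_, ?_⟩
    · rw [show ((V + 81 / 50 : ℝ) : ℂ) - V = ((81 / 50 : ℝ) : ℂ) by push_cast; ring, Complex.norm_real]; norm_num
    · rw [show ((V + 81 / 50 : ℝ) : ℂ) - V = ((81 / 50 : ℝ) : ℂ) by push_cast; ring, Complex.norm_real]; norm_num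
    · rw [Complex.ofReal_re]; norm_num
  refine ⟨((V + 81 / 50 : ℝ) : ℂ), hapex, fun {q} hq => ?_⟩
  rcases hq with ⟨h1, h2, h3⟩ | ⟨h1, h2, h3, h4, h5⟩
  · exact ((cap_joined V h1 h2 h3).mono hcapS).symm
  · -- the sign of `Im q` picks the leg
    obtain ⟨ε, hε, habs⟩ : ∃ ε : ℝ, (ε = 1 ∨ ε = -1) ∧ |V * q.im| = ε * (V * q.im) := by
      rcases le_or_gt 0 q.im with h | h
      · exact ⟨1, Or.inl rfl, by rw [abs_of_nonneg (by positivity), one_mul]⟩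
      · exact ⟨-1, Or.inr rfl, by rw [abs_of_neg (by nlinarith)]; ring⟩
    rw [habs] at h4 h5
    have hε2 : ε ^ 2 = 1 := by rcases hε with h | h <;> rw [h] <;> norm_num
    have hleg := (leg_joined hV hε2 h1 h2 h3 h4 h5).mono (hlegS ε hε)
    obtain ⟨⟨j1, j2, j3⟩, -⟩ := junction_mem hV hε
    have hcap := (cap_joined V j1 j2 j3).mono hcapS
    exact (hleg.trans hcap).symm

end ModelHandles

/-- **Registered piece `helper_handlebodyChart_modelHandles_coverTools` of the data stub, part 1 (tools for the cover
of the arches)**: continuation (`ModelHandles.subset_image_of_open_at`: a continuous map on a compact `K`, open at the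
points of an open `U ⊆ K` and mapping only points of `U` into a preconnected `A` meeting `f(U)`, satisfies
`A ⊆ f(K)`), and path-connectedness of the planar arch in the frame of the hole direction
(`ModelHandles.isPathConnected_archFrame`). [folklore] -/
theorem helper_handlebodyChart_modelHandles_coverTools : (∀ (f : EuclideanSpace ℝ (Fin 4) → EuclideanSpace ℝ (Fin 4)) (K U : Set (EuclideanSpace ℝ (Fin 4))) (A : Set (EuclideanSpace ℝ (Fin 4))), IsCompact K → ContinuousOn f K → U ⊆ K → IsOpen U → (∀ p ∈ U, ∀ s ∈ nhds p, f '' s ∈ nhds (f p)) → IsPreconnected A → (∀ p ∈ K, f p ∈ A → p ∈ U) → (A ∩ f '' U).Nonempty → A ⊆ f '' K) ∧ (∀ V : ℝ, 20 ≤ V → IsPathConnected {p : ℂ | (8 / 5 ≤ ‖p - V‖ ∧ ‖p - V‖ ≤ 41 / 25 ∧ -(7 / 10) ≤ p.re - V) ∨ (2 / 15 ≤ ‖p‖ ∧ ‖p‖ ≤ V + 1 / 2 ∧ 0 < p.re ∧ 8 / 5 * ‖p‖ ≤ |V * p.im| ∧ |V * p.im| ≤ 41 / 25 * ‖p‖)})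 :=
  ⟨fun _ _ _ _ hK hf hUK hUo hopen hA havoid hne => ModelHandles.subset_image_of_open_at hK hf hUK hUo hopen hA havoid hne,
   fun _ hV => ModelHandles.isPathConnected_archFrame hV⟩

end Summit.SmoothPoincare4.SmoothPoincare4.Theorems.DcrGap.MkFriends

end
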